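/-
COR-CM (cells pub-hodgecm / pub-hodgecm2, stage 2 of the Hodge ladder) — TEAM hCMisogE, sub-object (I2) WAVE 2 (hcmisog-lead l.5275 (1):
«when p301216 + part II are ✔, isog-2 APPENDS the hdetBC-free corollary»; writer hcmisog-isog-2 = prover-pub-hodgecm2-hcmisog-isog-2-0).
The base-change binder `hdetBC` of `Model.hCMisogE_of_det45` (`Transposition/Item6PinMatchDef45.lean`, p301919) DISCHARGED BY NAME from
b17's kernel theorem `Motives.AbelianVariety.det_cotangentMap_baseChange` (`Motives/AbelianVarietyCotangentBaseChangeIso.lean`, sub-object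
(L1b) part II; Görtz–Wedhorn I (6.6.2)–(6.6.3), Rem. 6.12; 0 named facts), and the Hodge-comparison binder `hW` DISCHARGED BY NAME from
hcmisog-lie-2's TRACK 2 theorem `HodgeTheory.cotangent_hodge10_comparison_holds` (`HodgeTheory/AbelianVarietyCotangentHodgeHolds.lean`, with
tr-prover-1's (T2-c) and hcmisog-lie-1's (T2-d); Lange–Birkenhake 1992 §1.1, Riemann's bilinear relations — kernel, 0 named facts).  Theorems
only; nothing asserted; HC_CM is NOT proved.
-/
import Summits.HodgeConjecture.CorCM.B01.Transposition.Item6PinMatchDef45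
import Literature.AlgebraicGeometry.Motives.AbelianVarietyCotangentBaseChangeIso
import Literature.AlgebraicGeometry.HodgeTheory.AbelianVarietyCotangentHodgeHolds
import HarnessLib

/-!
# Item (vi) S2, CM side: `hCMisogE` from [Liu 2021] Def. 4.5 (2) — the base-change binder discharged (TEAM hCMisogE, (I2) wave 2)

`Model.hCMisogE_of_det45` (p301919) derives the binder `hCMisogE` of pin-3's END display from [Liu2021] Def. 4.5 (2) AS PRINTED (carrier
`iμ₀` = «`i_μ : M_μ → End_E(A_μ)_ℚ`», l. 1948; binders `hdim` = «CM structure», `hdet45` = FIRST BULLET l. 1950 on the cotangent space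
over `E`), the Hodge comparison `hW : cotangent_hodge10_comparison` and ONE object-independent base-change law

  `hdetBC : ∀ K L (A : AbelianVariety K) (u : End A), det (T_e^*(u_L)) = algebraMap K L (det (T_e^*(u)))`,

stated token for token as the type of b17's theorem `det_cotangentMap_baseChange` (at universe `0`).  Now that this theorem and
TRACK 2's `cotangent_hodge10_comparison_holds` are in the tree, THIS FILE removes both binders in two steps:

* `Model.det_cotangentMap_baseChange_law` — the law itself, `fun _ _ L _ _ _ u => AbelianVariety.det_cotangentMap_baseChange L u`.
* `Model.exists_isogeny_isCMTypeRealisation_baseChange_of_det45'`, `…_of_cmDatum'` — the one-object theorems of p301919 without `hdetBC`.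
* `Model.hCMisogE_of_def45 (hW : cotangent_hodge10_comparison) (D) (Aμ₀) (iμ₀) (hdim) (hdet45) : <EXACTLY the binder hCMisogE>` — the
  family form with the Hodge comparison still a binder (wave 2).
* `Model.exists_isogeny_isCMTypeRealisation_baseChange_of_liu45`, `…_of_cmDatum_liu45` and
  **`Model.hCMisogE_of_liu45 (D) (Aμ₀) (iμ₀) (hdim) (hdet45) : <EXACTLY the binder hCMisogE>`** (wave 3) — `hW :=
  cotangent_hodge10_comparison_holds` as well: after it the CM side of the END display carries ONLY the carrier `iμ₀` and the two
  Liu-data readings `hdim`/`hdet45` ([Liu2021] Def. 4.5 (2), ll. 1948–1950 = the REAL fields of the landed `Def45.CMDatum`) — no cite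
  binder, no base-change binder, no identification binder.

NOT claimed: that Liu's `A_μ` (an object of `𝒜(μ)`, [Liu2021] Prop. 4.6 (1)) is constructed; that HC_CM is proved.

References: Y. Liu, arXiv:2102.11518 = Camb. J. Math. 9 (2021), Def. 4.5 (FJcycle.tex ll. 1936–1964); U. Görtz, T. Wedhorn, *Algebraic
Geometry I* (2020) (6.6.2)–(6.6.3), Rem. 6.12; G. Shimura (1998) §5.2, §7.1 Prop. 7; H. Lange, Ch. Birkenhake (1992) §1.1.
-/

noncomputable section

open scoped TensorProduct

namespace Summit.HodgeConjecture.CorCM.Model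

open CategoryTheory NumberField
open Literature.AlgebraicGeometry.Motives
open Literature.AlgebraicGeometry.HodgeTheory
open Literature.AlgebraicGeometry.ComplexMultiplication
open Literature.NumberTheory.ComplexMultiplication
open Literature.NumberTheory.Automorphic
open Literature.NumberTheory.Automorphic.IdeleClassGroup
open Literature.NumberTheory.Automorphic.PicardCM
open Literature.NumberTheory.Automorphic.Liu2021

/-- **The base-change law for determinants on cotangent spaces** (the binder `hdetBC` of `Model.hCMisogE_of_det45`, universe `0`):
for every abelian variety `A/K`, field extension `L/K` and `u ∈ End A`, `det (T_e^*(u_L)) = algebraMap K L (det T_e^*(u))` — b17's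
`Motives.AbelianVariety.det_cotangentMap_baseChange` (`T_e^*(A_L) ≅ L ⊗_K T_e^*(A)` compatibly with `u ↦ u_L`).
[cite: GortzWedhorn2020, (6.6.2)–(6.6.3) and Remark 6.12] -/
theorem det_cotangentMap_baseChange_law :
    ∀ (K : Type) [Field K] (L : Type) [Field L] [Algebra K L] (A : AbelianVariety K) (u : A ⟶ A),
      LinearMap.det (AbelianVariety.cotangentMap (A.baseChange L) (AbelianVariety.Hom.baseChange L u)) =
        algebraMap K L (LinearMap.det (AbelianVariety.cotangentMap A u)) :=
  fun _ _ L _ _ _ u => AbelianVariety.det_cotangentMap_baseChange L u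

/-- **[Liu2021, Def. 4.5 (2)] ⟹ the CM type of `A_μ ⊗_{E,σ} ℂ`, up to isogeny — ONE object, base change discharged**: p301919's
`exists_isogeny_isCMTypeRealisation_baseChange_of_det45` with `hdetBC := det_cotangentMap_baseChange_law`; conditional only on the Hodge
comparison `hW` (sub-object (L2)). [cite: Liu2021, Def. 4.5 (1)–(2) (FJcycle.tex ll. 1939–1951)] [cite: Shimura1998, §5.2 (pp. 36–37) and §7.1 Prop. 7 (p. 47)] -/
theorem exists_isogeny_isCMTypeRealisation_baseChange_of_det45' (hW : cotangent_hodge10_comparison)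
    {F : Type} [Field F] [NumberField F] [IsCMField F] [IsGalois ℚ F] (σ : F →+* ℂ)
    {μ : IdeleClassGroup F →ₜ* Circle} (hμ : IsConjugateSymplectic F μ)
    (A : AbelianVariety F) (i : muAlgValueField F μ →+* A.endAlgebra)
    (hdim : Module.finrank ℚ (muAlgValueField F μ) = 2 * A.dim)
    (hdet45 : ∀ (x : muAlgValueField F μ) (M : ℕ) (f : End A), M ≠ 0 →
      i x = algebraMap ℚ A.endAlgebra (M : ℚ)⁻¹ * AbelianVariety.endAlgebra.of A f →
        LinearMap.det (AbelianVariety.cotangentMap A f) = (M : F) ^ A.dim * Def45.eta (AlgHom.id ℚ F) σ hμ x)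
    (e : reflexField ℚ F (algValuedIn σ hμ.cmType.1) →+* muAlgValueField F μ)
    (he : ∀ k : reflexField ℚ F (algValuedIn σ hμ.cmType.1), ((e k : muAlgValueField F μ) : ℂ) = σ k) :
    haveI := hμ.numberField_muAlgValueField
    ∃ (B : AbelianVariety ℂ) (g : (letI := σ.toAlgebra; A.baseChange ℂ) ⟶ B), AbelianVariety.IsIsogeny g ∧
      ∃ (ιB : 𝓞 (muAlgValueField F μ) →+* End B)
        (θB : muAlgValueField F μ →+* Module.End ℂ (complexBetti B.X 1)),
        IsCMTypeRealisation (inducedCMType e (reflexCMType σ hμ.cmType (AlgHom.id ℚ F))) B ιB θB :=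
  exists_isogeny_isCMTypeRealisation_baseChange_of_det45 hW det_cotangentMap_baseChange_law σ hμ A i hdim hdet45 e he

/-- **The same PER OBJECT `X : Def45.CMDatum …`** of item6-p1's as-printed typing, base change discharged (p301919's `…_of_cmDatum` with
`hdetBC := det_cotangentMap_baseChange_law`). [cite: Liu2021, Def. 4.5 (2) (FJcycle.tex ll. 1944–1951)] -/
theorem exists_isogeny_isCMTypeRealisation_baseChange_of_cmDatum' (hW : cotangent_hodge10_comparison)
    {F : Type} [Field F] [NumberField F] [IsCMField F] [IsGalois ℚ F] (σ : F →+* ℂ)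
    {μ : IdeleClassGroup F →ₜ* Circle} {hμ : IsConjugateSymplectic F μ} {hw : HasWeight F μ 1} {C : Def45.Carriers F μ}
    (X : Def45.CMDatum (AlgHom.id ℚ F) σ hμ hw C)
    (e : reflexField ℚ F (algValuedIn σ hμ.cmType.1) →+* muAlgValueField F μ)
    (he : ∀ k : reflexField ℚ F (algValuedIn σ hμ.cmType.1), ((e k : muAlgValueField F μ) : ℂ) = σ k) :
    haveI := hμ.numberField_muAlgValueField
    ∃ (B : AbelianVariety ℂ) (g : (letI := σ.toAlgebra; X.A.baseChange ℂ) ⟶ B), AbelianVariety.IsIsogeny g ∧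
      ∃ (ιB : 𝓞 (muAlgValueField F μ) →+* End B)
        (θB : muAlgValueField F μ →+* Module.End ℂ (complexBetti B.X 1)),
        IsCMTypeRealisation (inducedCMType e (reflexCMType σ hμ.cmType (AlgHom.id ℚ F))) B ιB θB :=
  exists_isogeny_isCMTypeRealisation_baseChange_of_cmDatum hW det_cotangentMap_baseChange_law σ X e he

/-- **`hCMisogE` from [Liu2021] Def. 4.5 (2) AS PRINTED, base change discharged** — EXACTLY the type of the binder `hCMisogE` of
`Model.hc_cm_of_thm418AsPrinted_pinnedE_isog` (= pin-2's `hCMisog`, `Item6PinMatch.lean`:352, at the `E`-rational pin), from the carriers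
`D`, `Aμ₀` («`A_μ` … over `E`», l. 1946), `iμ₀` («`i_μ : M_μ → End_E(A_μ)_ℚ`», l. 1948, RATIONAL), the cite binder
`hW : cotangent_hodge10_comparison` (sub-object (L2)) and the two Liu-data readings `hdim` («CM structure», l. 1948), `hdet45` (FIRST BULLET
l. 1950 = the landed field `Def45.CMDatum.det45` on the pin), each guarded `IsGalois ℚ F → 6 ≤ [F:ℚ] → ι₁ ∈ Φ`.  Proof: p301919's
`hCMisogE_of_det45` at `hdetBC := det_cotangentMap_baseChange_law` (b17's theorem).  HC_CM is NOT proved; `hW`, `hdim`, `hdet45` are not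
inhabited here. [cite: Liu2021, Def. 4.5 (1)–(2) (FJcycle.tex ll. 1939–1951), Def. 4.3 (2) (l. 1919) and §4.1 l. 1928]
[cite: Shimura1998, §5.2 (pp. 36–37) and §7.1 Prop. 7 (p. 47)] [cite: GortzWedhorn2020, (6.6.2)–(6.6.3) and Remark 6.12] -/
theorem hCMisogE_of_def45 (hW : cotangent_hodge10_comparison)
    (D : ∀ (F : CMField) (ι₁ : F →+* ℂ) (_ : HermSpace3 F ι₁) (_ : CMType F), Thm418Data (maximalRealSubfield F) F)
    (Aμ₀ : ∀ (F : CMField) (ι₁ : F →+* ℂ) (V : HermSpace3 F ι₁) (Φ : CMType F), (D F ι₁ V Φ).Obj → AbelianVariety F)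
    (iμ₀ : ∀ (F : CMField) (ι₁ : F →+* ℂ) (V : HermSpace3 F ι₁) (Φ : CMType F) (Dμ : (D F ι₁ V Φ).Obj),
      muAlgValueField F (D F ι₁ V Φ).μ →+* (Aμ₀ F ι₁ V Φ Dμ).endAlgebra)
    (hdim : ∀ (F : CMField) [IsGalois ℚ F], 6 ≤ Module.finrank ℚ F → ∀ (Φ : CMType F) (ι₁ : F →+* ℂ), ι₁ ∈ Φ.1 →
      ∀ (V : HermSpace3 F ι₁) (Dμ : (D F ι₁ V Φ).Obj),
        Module.finrank ℚ (muAlgValueField F (D F ι₁ V Φ).μ) = 2 * (Aμ₀ F ι₁ V Φ Dμ).dim)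
    (hdet45 : ∀ (F : CMField) [IsGalois ℚ F], 6 ≤ Module.finrank ℚ F → ∀ (Φ : CMType F) (ι₁ : F →+* ℂ), ι₁ ∈ Φ.1 →
      ∀ (V : HermSpace3 F ι₁) (Dμ : (D F ι₁ V Φ).Obj) (x : muAlgValueField F (D F ι₁ V Φ).μ) (M : ℕ)
        (f : End (Aμ₀ F ι₁ V Φ Dμ)), M ≠ 0 →
        iμ₀ F ι₁ V Φ Dμ x =
          algebraMap ℚ (Aμ₀ F ι₁ V Φ Dμ).endAlgebra (M : ℚ)⁻¹ * AbelianVariety.endAlgebra.of (Aμ₀ F ι₁ V Φ Dμ) f →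
        LinearMap.det (AbelianVariety.cotangentMap (Aμ₀ F ι₁ V Φ Dμ) f) =
          (M : F) ^ (Aμ₀ F ι₁ V Φ Dμ).dim * Def45.eta (AlgHom.id ℚ F) ι₁ (D F ι₁ V Φ).isConjugateSymplectic x) :
    ∀ (F : CMField) [IsGalois ℚ F], 6 ≤ Module.finrank ℚ F → ∀ (Φ : CMType F) (ι₁ : F →+* ℂ), ι₁ ∈ Φ.1 →
      ∀ (V : HermSpace3 F ι₁) (Dμ : (D F ι₁ V Φ).Obj),
        haveI := (D F ι₁ V Φ).isConjugateSymplectic.numberField_muAlgValueField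
        ∀ e : reflexField ℚ F (algValuedIn ι₁ (D F ι₁ V Φ).cmType.1) →+* muAlgValueField F (D F ι₁ V Φ).μ,
          (∀ k : reflexField ℚ F (algValuedIn ι₁ (D F ι₁ V Φ).cmType.1),
            ((e k : muAlgValueField F (D F ι₁ V Φ).μ) : ℂ) = ι₁ k) →
          ∃ (B : AbelianVariety ℂ) (g : (letI := ι₁.toAlgebra; (Aμ₀ F ι₁ V Φ Dμ).baseChange ℂ) ⟶ B),
            AbelianVariety.IsIsogeny g ∧
            ∃ (ιB : 𝓞 (muAlgValueField F (D F ι₁ V Φ).μ) →+* End B)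
              (θB : muAlgValueField F (D F ι₁ V Φ).μ →+* Module.End ℂ (complexBetti B.X 1)),
              IsCMTypeRealisation (inducedCMType e (reflexCMType ι₁ (D F ι₁ V Φ).cmType (AlgHom.id ℚ F))) B ιB θB :=
  hCMisogE_of_det45 hW det_cotangentMap_baseChange_law D Aμ₀ iμ₀ hdim hdet45


/-! ## Wave 3: the Hodge comparison discharged as well (TRACK 2, `cotangent_hodge10_comparison_holds`) -/

/-- **[Liu2021, Def. 4.5 (2)] ⟹ the CM type of `A_μ ⊗_{E,σ} ℂ`, up to isogeny — ONE object, UNCONDITIONAL**: for a CM field `F` Galois over `ℚ`,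
a pin `σ : F → ℂ`, a conjugate-symplectic `μ` with value field `M_μ`, an abelian variety `A/F` with a RATIONAL structure `i : M_μ → End⁰(A)`,
`[M_μ:ℚ] = 2 dim A` («CM structure», l. 1948) and the FIRST BULLET (l. 1950) on the cotangent space over `F`, the base change `A ⊗_{F,σ} ℂ`
is isogenous to an `𝓞_{M_μ}`-realisation on `H¹` of the induced type `inducedCMType e_μ (reflexCMType σ Φ_μ id)`.  Proof: p301919's theorem
at `hW := cotangent_hodge10_comparison_holds` (hcmisog-lie-2, TRACK 2) and `hdetBC := det_cotangentMap_baseChange_law` (b17).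
[cite: Liu2021, Def. 4.5 (1)–(2) (FJcycle.tex ll. 1939–1951), Def. 4.3 (2) (l. 1919) and §4.1 l. 1928]
[cite: Shimura1998, §5.2 (pp. 36–37) and §7.1 Prop. 7 (p. 47)] [cite: LangeBirkenhake1992, §1.1 (1.6), Lemma 1.1.22 and Theorem 1.1.21] -/
theorem exists_isogeny_isCMTypeRealisation_baseChange_of_liu45
    {F : Type} [Field F] [NumberField F] [IsCMField F] [IsGalois ℚ F] (σ : F →+* ℂ)
    {μ : IdeleClassGroup F →ₜ* Circle} (hμ : IsConjugateSymplectic F μ)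
    (A : AbelianVariety F) (i : muAlgValueField F μ →+* A.endAlgebra)
    (hdim : Module.finrank ℚ (muAlgValueField F μ) = 2 * A.dim)
    (hdet45 : ∀ (x : muAlgValueField F μ) (M : ℕ) (f : End A), M ≠ 0 →
      i x = algebraMap ℚ A.endAlgebra (M : ℚ)⁻¹ * AbelianVariety.endAlgebra.of A f →
        LinearMap.det (AbelianVariety.cotangentMap A f) = (M : F) ^ A.dim * Def45.eta (AlgHom.id ℚ F) σ hμ x)
    (e : reflexField ℚ F (algValuedIn σ hμ.cmType.1) →+* muAlgValueField F μ)
    (he : ∀ k : reflexField ℚ F (algValuedIn σ hμ.cmType.1), ((e k : muAlgValueField F μ) : ℂ) = σ k) :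
    haveI := hμ.numberField_muAlgValueField
    ∃ (B : AbelianVariety ℂ) (g : (letI := σ.toAlgebra; A.baseChange ℂ) ⟶ B), AbelianVariety.IsIsogeny g ∧
      ∃ (ιB : 𝓞 (muAlgValueField F μ) →+* End B)
        (θB : muAlgValueField F μ →+* Module.End ℂ (complexBetti B.X 1)),
        IsCMTypeRealisation (inducedCMType e (reflexCMType σ hμ.cmType (AlgHom.id ℚ F))) B ιB θB :=
  exists_isogeny_isCMTypeRealisation_baseChange_of_det45 cotangent_hodge10_comparison_holds det_cotangentMap_baseChange_law
    σ hμ A i hdim hdet45 e he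

/-- **The same PER OBJECT `X : Def45.CMDatum …`, UNCONDITIONAL** (hcmisog-lead D4): every object `D_μ = (A_μ, i_μ, λ_μ, r_μ)` of item6-p1's
as-printed typing of [Liu2021] Def. 4.5 (2) has `A_μ ⊗_{E,σ} ℂ` isogenous to an `𝓞_{M_μ}`-realisation of `inducedCMType e_μ (reflexCMType σ Φ_μ id)`.
[cite: Liu2021, Def. 4.5 (2) (FJcycle.tex ll. 1944–1951)] [cite: Shimura1998, §5.2 (pp. 36–37) and §7.1 Prop. 7 (p. 47)] -/
theorem exists_isogeny_isCMTypeRealisation_baseChange_of_cmDatum_liu45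
    {F : Type} [Field F] [NumberField F] [IsCMField F] [IsGalois ℚ F] (σ : F →+* ℂ)
    {μ : IdeleClassGroup F →ₜ* Circle} {hμ : IsConjugateSymplectic F μ} {hw : HasWeight F μ 1} {C : Def45.Carriers F μ}
    (X : Def45.CMDatum (AlgHom.id ℚ F) σ hμ hw C)
    (e : reflexField ℚ F (algValuedIn σ hμ.cmType.1) →+* muAlgValueField F μ)
    (he : ∀ k : reflexField ℚ F (algValuedIn σ hμ.cmType.1), ((e k : muAlgValueField F μ) : ℂ) = σ k) :
    haveI := hμ.numberField_muAlgValueField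
    ∃ (B : AbelianVariety ℂ) (g : (letI := σ.toAlgebra; X.A.baseChange ℂ) ⟶ B), AbelianVariety.IsIsogeny g ∧
      ∃ (ιB : 𝓞 (muAlgValueField F μ) →+* End B)
        (θB : muAlgValueField F μ →+* Module.End ℂ (complexBetti B.X 1)),
        IsCMTypeRealisation (inducedCMType e (reflexCMType σ hμ.cmType (AlgHom.id ℚ F))) B ιB θB :=
  exists_isogeny_isCMTypeRealisation_baseChange_of_cmDatum cotangent_hodge10_comparison_holds det_cotangentMap_baseChange_law σ X e he

/-- **`hCMisogE` from [Liu2021] Def. 4.5 (2) AS PRINTED — Liu DATA readings ONLY.**  EXACTLY the type of the binder `hCMisogE` of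
`Model.hc_cm_of_thm418AsPrinted_pinnedE_isog` (= pin-2's `hCMisog`, `Item6PinMatch.lean`:352, at the `E`-rational pin `(Aμ₀ …).baseChange ℂ`),
from the carriers `D`, `Aμ₀` («`A_μ` is an abelian variety over `E`», l. 1946), `iμ₀` («`i_μ : M_μ → End_E(A_μ)_ℚ`», l. 1948, RATIONAL —
decision (α)) and the two face-guarded readings `hdim` («is a CM structure», l. 1948: `[M_μ:ℚ] = 2 dim A_μ`) and `hdet45` (FIRST BULLET,
l. 1950: «the determinant of the action of `i_μ(x)` on the `E`-vector space `Lie_E(A_μ)` equals `η_μ(x)`», typed on `Lie^∨ = 𝔪_e/𝔪_e²` for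
every presentation `i_μ(x) = M⁻¹ · (1 ⊗ f)` = the body of the landed field `Def45.CMDatum.det45`, with Liu's DEFINED
`η_μ = Def45.eta id ι₁ Φ_μ`).  The Hodge `(1,0)`/cotangent comparison (TRACK 2, `cotangent_hodge10_comparison_holds`) and the base change of the
cotangent space (b17, `det_cotangentMap_baseChange`) are THEOREMS consumed by name; the `𝓞_{M_μ}`-saturation isogeny is binder-1's p299960.
HC_CM is NOT proved; `hdim`/`hdet45` are inhabited exactly by an object of `𝒜(μ)` ([Liu2021] Prop. 4.6 (1), the display's `hObj`).
[cite: Liu2021, Def. 4.5 (1)–(2) (FJcycle.tex ll. 1939–1951), Def. 4.3 (2) (l. 1919), §4.1 l. 1928 and Prop. 4.6 (1) (l. 1969)]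
[cite: Shimura1998, §5.2 (pp. 36–37) and §7.1 Prop. 7 (p. 47)] [cite: LangeBirkenhake1992, §1.1 (1.6) and Theorem 1.1.21]
[cite: GortzWedhorn2020, (6.6.2)–(6.6.3) and Remark 6.12] -/
theorem hCMisogE_of_liu45
    (D : ∀ (F : CMField) (ι₁ : F →+* ℂ) (_ : HermSpace3 F ι₁) (_ : CMType F), Thm418Data (maximalRealSubfield F) F)
    (Aμ₀ : ∀ (F : CMField) (ι₁ : F →+* ℂ) (V : HermSpace3 F ι₁) (Φ : CMType F), (D F ι₁ V Φ).Obj → AbelianVariety F)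
    (iμ₀ : ∀ (F : CMField) (ι₁ : F →+* ℂ) (V : HermSpace3 F ι₁) (Φ : CMType F) (Dμ : (D F ι₁ V Φ).Obj),
      muAlgValueField F (D F ι₁ V Φ).μ →+* (Aμ₀ F ι₁ V Φ Dμ).endAlgebra)
    (hdim : ∀ (F : CMField) [IsGalois ℚ F], 6 ≤ Module.finrank ℚ F → ∀ (Φ : CMType F) (ι₁ : F →+* ℂ), ι₁ ∈ Φ.1 →
      ∀ (V : HermSpace3 F ι₁) (Dμ : (D F ι₁ V Φ).Obj),
        Module.finrank ℚ (muAlgValueField F (D F ι₁ V Φ).μ) = 2 * (Aμ₀ F ι₁ V Φ Dμ).dim)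
    (hdet45 : ∀ (F : CMField) [IsGalois ℚ F], 6 ≤ Module.finrank ℚ F → ∀ (Φ : CMType F) (ι₁ : F →+* ℂ), ι₁ ∈ Φ.1 →
      ∀ (V : HermSpace3 F ι₁) (Dμ : (D F ι₁ V Φ).Obj) (x : muAlgValueField F (D F ι₁ V Φ).μ) (M : ℕ)
        (f : End (Aμ₀ F ι₁ V Φ Dμ)), M ≠ 0 →
        iμ₀ F ι₁ V Φ Dμ x =
          algebraMap ℚ (Aμ₀ F ι₁ V Φ Dμ).endAlgebra (M : ℚ)⁻¹ * AbelianVariety.endAlgebra.of (Aμ₀ F ι₁ V Φ Dμ) f →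
        LinearMap.det (AbelianVariety.cotangentMap (Aμ₀ F ι₁ V Φ Dμ) f) =
          (M : F) ^ (Aμ₀ F ι₁ V Φ Dμ).dim * Def45.eta (AlgHom.id ℚ F) ι₁ (D F ι₁ V Φ).isConjugateSymplectic x) :
    ∀ (F : CMField) [IsGalois ℚ F], 6 ≤ Module.finrank ℚ F → ∀ (Φ : CMType F) (ι₁ : F →+* ℂ), ι₁ ∈ Φ.1 →
      ∀ (V : HermSpace3 F ι₁) (Dμ : (D F ι₁ V Φ).Obj),
        haveI := (D F ι₁ V Φ).isConjugateSymplectic.numberField_muAlgValueField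
        ∀ e : reflexField ℚ F (algValuedIn ι₁ (D F ι₁ V Φ).cmType.1) →+* muAlgValueField F (D F ι₁ V Φ).μ,
          (∀ k : reflexField ℚ F (algValuedIn ι₁ (D F ι₁ V Φ).cmType.1),
            ((e k : muAlgValueField F (D F ι₁ V Φ).μ) : ℂ) = ι₁ k) →
          ∃ (B : AbelianVariety ℂ) (g : (letI := ι₁.toAlgebra; (Aμ₀ F ι₁ V Φ Dμ).baseChange ℂ) ⟶ B),
            AbelianVariety.IsIsogeny g ∧
            ∃ (ιB : 𝓞 (muAlgValueField F (D F ι₁ V Φ).μ) →+* End B)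
              (θB : muAlgValueField F (D F ι₁ V Φ).μ →+* Module.End ℂ (complexBetti B.X 1)),
              IsCMTypeRealisation (inducedCMType e (reflexCMType ι₁ (D F ι₁ V Φ).cmType (AlgHom.id ℚ F))) B ιB θB :=
  hCMisogE_of_det45 cotangent_hodge10_comparison_holds det_cotangentMap_baseChange_law D Aμ₀ iμ₀ hdim hdet45

end Summit.HodgeConjecture.CorCM.Model

end
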